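import Mathlib
import HarnessLib
import Summits.Ventures.LatticeQCDFlow.Exactness.SU2WilsonFlowLOTranslation
import Summits.Ventures.LatticeQCDFlow.Exactness.PTBCTranslationErgodic
import Literature.MathematicalPhysics.QuantumLattice.GaugeGroups
import Literature.MathematicalPhysics.QuantumFieldTheory.LatticeGaugeProofs

/-!
# Lattice translations preserve the product Haar measure, every translation-invariant Gibbs law and the Wilson measure; the PTBC translation move of the periodic replica by a lattice shift is exact

HONEST FRAMING: exact (Metropolis-corrected) sampling algorithms for lattice gauge theory;
figures of merit are autocorrelation/cost numbers at stated couplings and volumes; no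
continuum-physics claim.

Venture `LatticeQCDFlow` (cell pub-lqcd), topic `Exactness`; FANOUT row 14 (`eng-flowhmc`) — the
measure-side companion of `SU2WilsonFlowLOTranslation` (map side) and of GEN-10's kernel-side
`SU2FTHMCTranslationCovariance`; it also discharges, for the LATTICE SHIFT, the two hypotheses
`hT` / `hST` of row 9's `PTBCTranslationErgodic.ptbcTranslation_invariant_ptbcTarget` (listed there
as NOT CLAIMED: "that the engine's shift IS such a `T` … a permutation of the edges preserving product
Haar and the periodic Wilson action — true, not typed here").  NEW WORK of the cell; nothing is cited
as a fact; no number.  A translation `t : Site d L` acts by `(V·t)(x, μ) = V(x + t, μ)`.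

* **`measurePreserving_translate_pi`** — for ANY σ-finite one-link law `μ` (any measurable group or
  space), `V ↦ V·t` preserves the product law `⊗_e μ` (it is the coordinate permutation
  `MeasurableEquiv.piCongrLeft` of `Mathlib`'s `measurePreserving_piCongrLeft`);
* **`measurePreserving_translate_gibbs`** — hence it preserves every Gibbs law `e^(−S) · ⊗_e μ` with
  a translation-invariant measurable action `S` (row 9's `measurePreserving_withDensity_of_actionInvariant`);
* **`measurePreserving_translate_wilsonWeight`**, **`map_translate_wilsonMeasure`** — in particular
  the Wilson weight / Wilson probability measure `wilsonMeasure ρ β` of the tree (`ConstructiveQFTWave0`),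
  for every compact group `G`, continuous representation `ρ` and coupling `β`
  (`wilsonAction_comp_translate`);
* **`ptbcTranslation_latticeShift_invariant`** — row 9's lifted PTBC translation move, instantiated
  with the lattice shift `Θ_t` on replica `r₀` (one-link laws any probability measure `μ`, tempered
  bounded measurable actions `S q`, `S r₀` translation invariant): EXACT for the product of the
  tempered Gibbs laws; **`ptbcTranslation_latticeShift_invariant_wilson`** — with `S r₀ = β·S_W`
  (the periodic replica) nothing is left to assume about the move; **`ptbc_full_latticeShift_uniformlyErgodic`**
  — the full PTBC cycle (heat baths, swaps, lattice shift of replica `r₀`) converges geometrically to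
  the product target from every start.

NOT CLAIMED: which shift the engine draws (any `t` is covered); defect replicas' actions (only the
shifted replica's action must be translation invariant, as in row 9's theorem); rates beyond row 9's;
any number.
-/

noncomputable section

namespace Summit.Ventures.LatticeQCDFlow.Exactness

open MeasureTheory ProbabilityTheory
open Literature.MathematicalPhysics.QuantumFieldTheory
open scoped ENNReal

variable {d L : ℕ} [NeZero L]

/-! ## Product laws and Gibbs laws -/

section Product

variable {G : Type*} [MeasurableSpace G]

/-- **Lattice translations preserve every product one-link law** `⊗_e μ` (`μ` σ-finite). -/
theorem measurePreserving_translate_pi (μ : Measure G) [SigmaFinite μ] (t : Site d L) :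
    MeasurePreserving (fun V : GaugeConfig d L G => (fun e : Edge d L => V (e.1 + t, e.2)))
      (Measure.pi fun _ : Edge d L => μ) (Measure.pi fun _ : Edge d L => μ) := by
  let σ : Edge d L ≃ Edge d L := Equiv.prodCongr (Equiv.addRight t) (Equiv.refl (Fin d))
  have h := measurePreserving_piCongrLeft (fun _ : Edge d L => μ) σ.symm
  have hR : ⇑(MeasurableEquiv.piCongrLeft (fun _ : Edge d L => G) σ.symm) =
      (fun V : GaugeConfig d L G => (fun e : Edge d L => V (e.1 + t, e.2))) := by
    funext V e
    change (Equiv.piCongrLeft (fun _ : Edge d L => G) σ.symm) V e = _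
    rw [Equiv.piCongrLeft_apply_eq_cast, cast_eq]
    rfl
  rw [hR] at h
  exact h

/-- **Lattice translations preserve every translation-invariant Gibbs law** `e^(−S) · ⊗_e μ`. -/
theorem measurePreserving_translate_gibbs (μ : Measure G) [SigmaFinite μ] (t : Site d L)
    {S : GaugeConfig d L G → ℝ} (hS : Measurable S)
    (hSt : ∀ V : GaugeConfig d L G, S (fun e : Edge d L => V (e.1 + t, e.2)) = S V) :
    MeasurePreserving (fun V : GaugeConfig d L G => (fun e : Edge d L => V (e.1 + t, e.2)))
      ((Measure.pi fun _ : Edge d L => μ).withDensity fun V => ENNReal.ofReal (Real.exp (-S V)))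
      ((Measure.pi fun _ : Edge d L => μ).withDensity fun V => ENNReal.ofReal (Real.exp (-S V))) :=
  measurePreserving_withDensity_of_actionInvariant
    ({ toFun := fun V : GaugeConfig d L G => (fun e : Edge d L => V (e.1 + t, e.2)),
       invFun := fun V : GaugeConfig d L G => (fun e : Edge d L => V (e.1 - t, e.2)),
       left_inv := fun V => funext fun e => by simp only [sub_add_cancel],
       right_inv := fun V => funext fun e => by simp only [add_sub_cancel_right],
       measurable_toFun := measurable_pi_lambda _ fun e => measurable_pi_apply _,
       measurable_invFun := measurable_pi_lambda _ fun e => measurable_pi_apply _ } : GaugeConfig d L G ≃ᵐ GaugeConfig d L G)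
    (measurePreserving_translate_pi μ t) hS hSt

end Product

/-! ## The Wilson measure -/

section Wilson

variable {G : Type*} [Group G] [TopologicalSpace G] [IsTopologicalGroup G] [CompactSpace G]
  [MeasurableSpace G] [BorelSpace G] {N : ℕ} (ρ : G →* Matrix (Fin N) (Fin N) ℂ)

/-- **Lattice translations preserve the Wilson weight** `exp(−β S_W) · ⊗_e Haar` (compact `G`,
continuous `ρ`, any `β`). -/
theorem measurePreserving_translate_wilsonWeight (hρ : Continuous ρ) (β : ℝ) (t : Site d L) :
    MeasurePreserving (fun V : GaugeConfig d L G => (fun e : Edge d L => V (e.1 + t, e.2)))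
      (wilsonWeight (d := d) (L := L) ρ β) (wilsonWeight (d := d) (L := L) ρ β) := by
  have hfun : (fun U : GaugeConfig d L G => ENNReal.ofReal (Real.exp (-β * wilsonAction ρ U))) =
      fun U : GaugeConfig d L G => ENNReal.ofReal (Real.exp (-((fun W : GaugeConfig d L G => β * wilsonAction ρ W) U))) := by
    funext U
    rw [neg_mul]
  unfold wilsonWeight
  rw [hfun]
  exact measurePreserving_translate_gibbs (haarProbability G) t
    ((WilsonRP.measurable_wilsonAction ρ hρ).const_mul β)
    (fun V => by rw [wilsonAction_comp_translate])

/-- **The Wilson probability measure is translation invariant**: `(Θ_t)_* μ_(Λ,β) = μ_(Λ,β)`. -/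
theorem map_translate_wilsonMeasure (hρ : Continuous ρ) (β : ℝ) (t : Site d L) :
    (wilsonMeasure (d := d) (L := L) ρ β).map (fun V : GaugeConfig d L G => (fun e : Edge d L => V (e.1 + t, e.2))) =
      wilsonMeasure (d := d) (L := L) ρ β := by
  unfold wilsonMeasure
  rw [Measure.map_smul, (measurePreserving_translate_wilsonWeight ρ hρ β t).map_eq]

end Wilson

/-! ## Row 9's PTBC translation move, with the lattice shift -/

section PTBC

variable {G : Type*} [MeasurableSpace G] {R : Type*} [DecidableEq R] [Fintype R]

/-- **The PTBC translation move of replica `r₀` by a lattice shift is EXACT** for the product of the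
tempered Gibbs laws: one-link law any probability measure `μ`, tempered bounded measurable actions
`S q`, the shifted replica's action translation invariant. -/
theorem ptbcTranslation_latticeShift_invariant (μ : Measure G) [IsProbabilityMeasure μ]
    {S : R → GaugeConfig d L G → ℝ} (hS : ∀ q, Measurable (S q)) {a b : ℝ}
    (hab : ∀ q ω, a ≤ S q ω ∧ S q ω ≤ b) (r₀ : R) (t : Site d L)
    (hSt : ∀ V : GaugeConfig d L G, S r₀ (fun e : Edge d L => V (e.1 + t, e.2)) = S r₀ V) :
    Kernel.Invariant
      (ptbcTranslation
        ({ toFun := fun V : GaugeConfig d L G => (fun e : Edge d L => V (e.1 + t, e.2)),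
           invFun := fun V : GaugeConfig d L G => (fun e : Edge d L => V (e.1 - t, e.2)),
           left_inv := fun V => funext fun e => by simp only [sub_add_cancel],
           right_inv := fun V => funext fun e => by simp only [add_sub_cancel_right],
           measurable_toFun := measurable_pi_lambda _ fun e => measurable_pi_apply _,
           measurable_invFun := measurable_pi_lambda _ fun e => measurable_pi_apply _ } : GaugeConfig d L G ≃ᵐ GaugeConfig d L G)
        (MeasurableEquiv.measurable _) r₀)
      (ptbcTarget (fun _ : Edge d L => μ) (ptbcDensity S)) :=
  ptbcTranslation_invariant_ptbcTarget (μ := fun _ : Edge d L => μ) hS hab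
    ({ toFun := fun V : GaugeConfig d L G => (fun e : Edge d L => V (e.1 + t, e.2)),
       invFun := fun V : GaugeConfig d L G => (fun e : Edge d L => V (e.1 - t, e.2)),
       left_inv := fun V => funext fun e => by simp only [sub_add_cancel],
       right_inv := fun V => funext fun e => by simp only [add_sub_cancel_right],
       measurable_toFun := measurable_pi_lambda _ fun e => measurable_pi_apply _,
       measurable_invFun := measurable_pi_lambda _ fun e => measurable_pi_apply _ } : GaugeConfig d L G ≃ᵐ GaugeConfig d L G)
    (measurePreserving_translate_pi μ t) r₀ hSt

/-- **… with the periodic replica carrying `β·S_W`: nothing left to assume about the move** (any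
group and representation; the other replicas' actions are arbitrary; boundedness and measurability of
the tempered actions are row 9's standing hypotheses `hab`, `hS`). -/
theorem ptbcTranslation_latticeShift_invariant_wilson {G : Type*} [Group G] [MeasurableSpace G] {N : ℕ}
    (ρ : G →* Matrix (Fin N) (Fin N) ℂ) (μ : Measure G) [IsProbabilityMeasure μ]
    {S : R → GaugeConfig d L G → ℝ} (hS : ∀ q, Measurable (S q)) {a b : ℝ}
    (hab : ∀ q ω, a ≤ S q ω ∧ S q ω ≤ b) (r₀ : R) (β : ℝ)
    (hr₀ : ∀ V : GaugeConfig d L G, S r₀ V = β * wilsonAction ρ V) (t : Site d L) :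
    Kernel.Invariant
      (ptbcTranslation
        ({ toFun := fun V : GaugeConfig d L G => (fun e : Edge d L => V (e.1 + t, e.2)),
           invFun := fun V : GaugeConfig d L G => (fun e : Edge d L => V (e.1 - t, e.2)),
           left_inv := fun V => funext fun e => by simp only [sub_add_cancel],
           right_inv := fun V => funext fun e => by simp only [add_sub_cancel_right],
           measurable_toFun := measurable_pi_lambda _ fun e => measurable_pi_apply _,
           measurable_invFun := measurable_pi_lambda _ fun e => measurable_pi_apply _ } : GaugeConfig d L G ≃ᵐ GaugeConfig d L G)
        (MeasurableEquiv.measurable _) r₀)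
      (ptbcTarget (fun _ : Edge d L => μ) (ptbcDensity S)) :=
  ptbcTranslation_latticeShift_invariant μ hS hab r₀ t
    (fun V => by rw [hr₀, hr₀, wilsonAction_comp_translate])

/-- **The full PTBC cycle with the lattice shift is uniformly ergodic**: heat-bath scans on every
replica, the swaps along `P`, then the shift of replica `r₀` by `t` — row 9's
`ptbc_full_uniformlyErgodic` with its `T`-hypotheses discharged. -/
theorem ptbc_full_latticeShift_uniformlyErgodic (μ : Measure G) [IsProbabilityMeasure μ]
    {S : R → GaugeConfig d L G → ℝ} (hS : ∀ q, Measurable (S q)) {a b : ℝ}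
    (hab : ∀ q ω, a ≤ S q ω ∧ S q ω ≤ b) {l : List (Edge d L)} (hl : ∀ j, j ∈ l) {Lr : List R} (hL : ∀ r, r ∈ Lr)
    (P : List (R × R)) (r₀ : R) (t : Site d L)
    (hSt : ∀ V : GaugeConfig d L G, S r₀ (fun e : Edge d L => V (e.1 + t, e.2)) = S r₀ V)
    (μ₀ : Measure (R → GaugeConfig d L G)) [IsProbabilityMeasure μ₀] (n : ℕ) (A : Set (R → GaugeConfig d L G)) :
    |((fun ν : Measure (R → GaugeConfig d L G) =>
          ν.bind ((ptbcTranslation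
            ({ toFun := fun V : GaugeConfig d L G => (fun e : Edge d L => V (e.1 + t, e.2)),
               invFun := fun V : GaugeConfig d L G => (fun e : Edge d L => V (e.1 - t, e.2)),
               left_inv := fun V => funext fun e => by simp only [sub_add_cancel],
               right_inv := fun V => funext fun e => by simp only [add_sub_cancel_right],
               measurable_toFun := measurable_pi_lambda _ fun e => measurable_pi_apply _,
               measurable_invFun := measurable_pi_lambda _ fun e => measurable_pi_apply _ } : GaugeConfig d L G ≃ᵐ GaugeConfig d L G)
            (MeasurableEquiv.measurable _) r₀ ∘ₖ ptbcSwaps S P) ∘ₖ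
            replicaSweep (ptbcInReplica (fun _ : Edge d L => μ) (ptbcDensity S) l) Lr))^[n] μ₀).real A
        - (ptbcTarget (fun _ : Edge d L => μ) (ptbcDensity S)).real A| ≤
      (1 - (((ENNReal.ofReal (Real.exp (-b)) * (ENNReal.ofReal (Real.exp (-a)))⁻¹) ^ l.length) ^ Lr.length).toReal) ^ n :=
  ptbc_full_uniformlyErgodic (μ := fun _ : Edge d L => μ) hS hab hl hL P
    ({ toFun := fun V : GaugeConfig d L G => (fun e : Edge d L => V (e.1 + t, e.2)),
       invFun := fun V : GaugeConfig d L G => (fun e : Edge d L => V (e.1 - t, e.2)),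
       left_inv := fun V => funext fun e => by simp only [sub_add_cancel],
       right_inv := fun V => funext fun e => by simp only [add_sub_cancel_right],
       measurable_toFun := measurable_pi_lambda _ fun e => measurable_pi_apply _,
       measurable_invFun := measurable_pi_lambda _ fun e => measurable_pi_apply _ } : GaugeConfig d L G ≃ᵐ GaugeConfig d L G)
    (measurePreserving_translate_pi μ t) r₀ hSt μ₀ n A

end PTBC

end Summit.Ventures.LatticeQCDFlow.Exactness
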